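import Summits.KontsevichZagierPeriods.KontsevichZagierPeriods.Theses.LinkTwistWrithe
import Literature.NumberTheory.Transcendental.SemialgebraicMapsProofs
import Literature.NumberTheory.Transcendental.KZSemialgebraicComplex
import Literature.NumberTheory.Transcendental.KZIntervalPeriodProofs

/-!
# `ArchimedesCoV` (stmt-KontsevichZagierPeriods-4307, route LinkTwistWrithe) — proof

ARCHIMEDES' HAT-BOX THEOREM IS ONE MOVE OF RULE (2). For every representation `r = [ℝ², f]` with
`f = 4/(1+|w|²)²` on `ℝ²` (the area density of `S²` in the stereographic chart) and every
`r' = [{|v| < 2}, g]` with `g = 1` on the open disc of radius `2`, the difference `[r] − [r']` is a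
member of the move SET `KZ.changeOfVariablesRel` itself (not merely of the relations it generates).

The move is the radial Nash diffeomorphism `Φ(w) = 2w/√(1+|w|²)` of `ℝ²` onto the open disc of radius
`2` (inverse stereographic projection followed by Lambert's equal-area projection), with inverse
`Ψ(v) = v/√(4−|v|²)`:
* `Φ` is `ℚ`-semialgebraic (coordinates `2·wᵢ/√(1+|w|²)`: polynomial, square root, quotient);
* `Φ` is differentiable with Jacobian `Φ′(w) = (2S·δᵢⱼ − 2wᵢwⱼ)/(S√S)`, `S = 1+|w|²`, whose determinant
  is `4/S²` (so `|det Φ′(w)| = 4/(1+|w|²)² = f(w)`, `g ∘ Φ = 1`);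
* `Ψ ∘ Φ = id` (injectivity) and `Φ '' ℝ² = {|v| < 2}` (`|Φ w|² = 4 − 4/S < 4`, `Φ ∘ Ψ = id` on the disc).
-/

noncomputable section

open MeasureTheory Set
open Literature.NumberTheory.Transcendental
open Literature.ModelTheory.ExponentialFields (IsSemialgebraic isSemialgebraic_univ)
open MvPolynomial (aeval X C)

namespace Summit.KontsevichZagierPeriods.LinkTwistWrithe

/-- `√(1+|w|²)` is a positive real number `q` with `q² = 1+|w|²`. [folklore] -/
theorem exists_sqrt_oneAddSq (y : Fin 2 → ℝ) :
    ∃ q : ℝ, 0 < q ∧ q ^ 2 = 1 + y 0 ^ 2 + y 1 ^ 2 ∧ √(1 + y 0 ^ 2 + y 1 ^ 2) = q :=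
  ⟨_, Real.sqrt_pos.2 (by positivity), Real.sq_sqrt (by positivity), rfl⟩

/-- The Lambert map `Φ(w) = 2w/√(1+|w|²)` is a `ℚ`-semialgebraic map on `ℝ²`: each coordinate is the
rational constant `2` divided by the square root of the polynomial `1+|w|²`, times a coordinate
function. [cite: BCR1998, §2.2 (Prop. 2.2.6)] -/
theorem isSemialgebraicMapOn_lambert :
    IsSemialgebraicMapOn ℚ (Set.univ : Set (Fin 2 → ℝ))
      (fun w : Fin 2 → ℝ => (2 / √(1 + w 0 ^ 2 + w 1 ^ 2)) • w) := by
  have hS : IsSemialgebraicFunOn ℚ (Set.univ : Set (Fin 2 → ℝ))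
      (fun w : Fin 2 → ℝ => 1 + w 0 ^ 2 + w 1 ^ 2) :=
    (isSemialgebraicFunOn_aeval isSemialgebraic_univ (1 + X 0 ^ 2 + X 1 ^ 2 : MvPolynomial (Fin 2) ℚ)).congr
      fun w _ => by simp
  have hq : IsSemialgebraicFunOn ℚ (Set.univ : Set (Fin 2 → ℝ))
      (fun w : Fin 2 → ℝ => √(1 + w 0 ^ 2 + w 1 ^ 2)) := IsSemialgebraicFunOn.sqrt_holds hS
  have hc : IsSemialgebraicFunOn ℚ (Set.univ : Set (Fin 2 → ℝ))
      (fun w : Fin 2 → ℝ => 2 / √(1 + w 0 ^ 2 + w 1 ^ 2)) := by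
    refine ((isSemialgebraicFunOn_ratCast isSemialgebraic_univ 2).div hq fun w _ => ?_).congr
      fun w _ => by simp
    exact (Real.sqrt_pos.2 (by positivity)).ne'
  refine IsSemialgebraicMapOn.of_forall isSemialgebraic_univ fun i => ?_
  exact (IsSemialgebraicFunOn.mul_holds hc (isSemialgebraicFunOn_apply isSemialgebraic_univ i)).congr
    fun w _ => by simp [smul_eq_mul]

/-- The map `Ψ(v) = v/√(4−|v|²)` is a left inverse of the Lambert map `Φ(w) = 2w/√(1+|w|²)`
(`4 − |Φ w|² = 4/(1+|w|²)`). [folklore] -/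
theorem leftInverse_lambert :
    Function.LeftInverse
      (fun v : Fin 2 → ℝ => (1 / √(4 - (v 0 ^ 2 + v 1 ^ 2))) • v)
      (fun w : Fin 2 → ℝ => (2 / √(1 + w 0 ^ 2 + w 1 ^ 2)) • w) := by
  intro w
  obtain ⟨q, hq0, hq2, hq⟩ := exists_sqrt_oneAddSq w
  simp only [hq, Pi.smul_apply, smul_eq_mul, smul_smul]
  have key : 4 - ((2 / q * w 0) ^ 2 + (2 / q * w 1) ^ 2) = (2 / q) ^ 2 := by
    field_simp
    linear_combination 4 * hq2
  rw [key, Real.sqrt_sq (by positivity), one_div, inv_mul_cancel₀ (by positivity), one_smul]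

/-- The Lambert map `Φ(w) = 2w/√(1+|w|²)` maps `ℝ²` onto the open disc of radius `2`
(`|Φ w|² = 4 − 4/(1+|w|²) < 4`, and `Φ(Ψ v) = v` for `|v| < 2` with `Ψ(v) = v/√(4−|v|²)`). [folklore] -/
theorem image_lambert :
    (fun w : Fin 2 → ℝ => (2 / √(1 + w 0 ^ 2 + w 1 ^ 2)) • w) '' Set.univ =
      {v : Fin 2 → ℝ | v 0 ^ 2 + v 1 ^ 2 < 4} := by
  refine Set.ext fun v => ⟨?_, ?_⟩
  · rintro ⟨w, -, rfl⟩
    obtain ⟨q, hq0, hq2, hq⟩ := exists_sqrt_oneAddSq w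
    simp only [Set.mem_setOf_eq, Pi.smul_apply, smul_eq_mul, hq]
    rw [div_mul_eq_mul_div, div_mul_eq_mul_div, div_pow, div_pow, ← add_div,
      div_lt_iff₀ (by positivity)]
    nlinarith [hq2]
  · rintro (hv : v 0 ^ 2 + v 1 ^ 2 < 4)
    refine ⟨(1 / √(4 - (v 0 ^ 2 + v 1 ^ 2))) • v, Set.mem_univ _, ?_⟩
    obtain ⟨p, hp0, hp2, hp⟩ : ∃ p : ℝ, 0 < p ∧ p ^ 2 = 4 - (v 0 ^ 2 + v 1 ^ 2) ∧
        √(4 - (v 0 ^ 2 + v 1 ^ 2)) = p :=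
      ⟨_, Real.sqrt_pos.2 (by linarith), Real.sq_sqrt (by linarith), rfl⟩
    simp only [hp, Pi.smul_apply, smul_eq_mul, smul_smul]
    have key : 1 + (1 / p * v 0) ^ 2 + (1 / p * v 1) ^ 2 = (2 / p) ^ 2 := by
      field_simp
      linear_combination hp2
    rw [key, Real.sqrt_sq (by positivity),
      show 2 / (2 / p) * (1 / p) = 1 by field_simp, one_smul]

/-- The Jacobian `Φ′(w) = (2S·δᵢⱼ − 2wᵢwⱼ)/(S√S)`, `S = 1+|w|²`, of the Lambert map has absolute
determinant `4/(1+|w|²)²` (`Matrix.det_fin_two_of`; `(2S−2w₀²)(2S−2w₁²) − 4w₀²w₁² = 4S`). [folklore] -/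
theorem abs_det_lambert (y : Fin 2 → ℝ) :
    |(LinearMap.toContinuousLinearMap (Matrix.toLin' !![
        (2 * (1 + y 0 ^ 2 + y 1 ^ 2) - 2 * y 0 * y 0) /
          ((1 + y 0 ^ 2 + y 1 ^ 2) * √(1 + y 0 ^ 2 + y 1 ^ 2)),
        (-(2 * y 0 * y 1)) / ((1 + y 0 ^ 2 + y 1 ^ 2) * √(1 + y 0 ^ 2 + y 1 ^ 2));
        (-(2 * y 1 * y 0)) / ((1 + y 0 ^ 2 + y 1 ^ 2) * √(1 + y 0 ^ 2 + y 1 ^ 2)),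
        (2 * (1 + y 0 ^ 2 + y 1 ^ 2) - 2 * y 1 * y 1) /
          ((1 + y 0 ^ 2 + y 1 ^ 2) * √(1 + y 0 ^ 2 + y 1 ^ 2))])).det| =
      4 / (1 + y 0 ^ 2 + y 1 ^ 2) ^ 2 := by
  rw [LinearMap.det_toContinuousLinearMap, LinearMap.det_toLin', Matrix.det_fin_two_of]
  obtain ⟨q, hq0, hq2, hq⟩ := exists_sqrt_oneAddSq y
  rw [hq, ← hq2]
  have h1 : y 1 ^ 2 = q ^ 2 - 1 - y 0 ^ 2 := by linarith
  have key : (2 * q ^ 2 - 2 * y 0 * y 0) / (q ^ 2 * q) * ((2 * q ^ 2 - 2 * y 1 * y 1) / (q ^ 2 * q)) -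
      -(2 * y 0 * y 1) / (q ^ 2 * q) * (-(2 * y 1 * y 0) / (q ^ 2 * q)) = 4 / (q ^ 2) ^ 2 := by
    rw [div_mul_div_comm, div_mul_div_comm, ← sub_div, div_eq_div_iff (by positivity) (by positivity)]
    linear_combination (-(4 * q ^ 6)) * h1
  rw [key]
  exact abs_of_pos (by positivity)

/-- The Lambert map `Φ(w) = 2w/√(1+|w|²)` is differentiable with derivative its Jacobian
`(2S·δᵢⱼ − 2wᵢwⱼ)/(S√S)`, `S = 1+|w|²` (`hasFDerivAt_pi'`; product and chain rules for
`wᵢ · (2/√S)`). [folklore] -/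
theorem hasFDerivAt_lambert (y : Fin 2 → ℝ) :
    HasFDerivAt (fun w : Fin 2 → ℝ => (2 / √(1 + w 0 ^ 2 + w 1 ^ 2)) • w)
      (LinearMap.toContinuousLinearMap (Matrix.toLin' !![
        (2 * (1 + y 0 ^ 2 + y 1 ^ 2) - 2 * y 0 * y 0) /
          ((1 + y 0 ^ 2 + y 1 ^ 2) * √(1 + y 0 ^ 2 + y 1 ^ 2)),
        (-(2 * y 0 * y 1)) / ((1 + y 0 ^ 2 + y 1 ^ 2) * √(1 + y 0 ^ 2 + y 1 ^ 2));
        (-(2 * y 1 * y 0)) / ((1 + y 0 ^ 2 + y 1 ^ 2) * √(1 + y 0 ^ 2 + y 1 ^ 2)),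
        (2 * (1 + y 0 ^ 2 + y 1 ^ 2) - 2 * y 1 * y 1) /
          ((1 + y 0 ^ 2 + y 1 ^ 2) * √(1 + y 0 ^ 2 + y 1 ^ 2))])) y := by
  have hS0 : (0 : ℝ) < 1 + y 0 ^ 2 + y 1 ^ 2 := by positivity
  have h0 : HasFDerivAt (fun w : Fin 2 → ℝ => w 0)
      (ContinuousLinearMap.proj (R := ℝ) (φ := fun _ : Fin 2 => ℝ) 0) y := hasFDerivAt_apply 0 y
  have h1 : HasFDerivAt (fun w : Fin 2 → ℝ => w 1)
      (ContinuousLinearMap.proj (R := ℝ) (φ := fun _ : Fin 2 => ℝ) 1) y := hasFDerivAt_apply 1 y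
  have hS : HasFDerivAt (fun w : Fin 2 → ℝ => 1 + w 0 ^ 2 + w 1 ^ 2)
      ((2 • y 0 ^ (2 - 1)) • ContinuousLinearMap.proj (R := ℝ) (φ := fun _ : Fin 2 => ℝ) 0 +
        (2 • y 1 ^ (2 - 1)) • ContinuousLinearMap.proj (R := ℝ) (φ := fun _ : Fin 2 => ℝ) 1) y :=
    ((h0.pow 2).const_add 1).add (h1.pow 2)
  have hg : HasDerivAt (fun t : ℝ => 2 / √t)
      ((0 * √(1 + y 0 ^ 2 + y 1 ^ 2) - 2 * (1 / (2 * √(1 + y 0 ^ 2 + y 1 ^ 2)))) /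
        √(1 + y 0 ^ 2 + y 1 ^ 2) ^ 2) (1 + y 0 ^ 2 + y 1 ^ 2) :=
    (hasDerivAt_const _ (2 : ℝ)).div (Real.hasDerivAt_sqrt hS0.ne') (Real.sqrt_pos.2 hS0).ne'
  have hc := hg.comp_hasFDerivAt y hS
  obtain ⟨q, hq0, hq2, hq⟩ := exists_sqrt_oneAddSq y
  rw [hasFDerivAt_pi']
  refine Fin.forall_fin_two.mpr ⟨?_, ?_⟩
  · refine (hc.mul h0).congr_fderiv (ContinuousLinearMap.ext fun v => ?_)
    simp [Matrix.toLin'_apply, dotProduct, Fin.sum_univ_two, hq]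
    rw [← hq2]
    field_simp
    ring
  · refine (hc.mul h1).congr_fderiv (ContinuousLinearMap.ext fun v => ?_)
    simp [Matrix.toLin'_apply, dotProduct, Fin.sum_univ_two, hq]
    rw [← hq2]
    field_simp
    ring

/-- **`ArchimedesCoV`** (route LinkTwistWrithe, stmt-KontsevichZagierPeriods-4307): for every
`r = [ℝ², f]` with `f = 4/(1+|w|²)²` on `ℝ²` and every `r' = [{v₀²+v₁² < 4}, g]` with `g = 1` there,
`[r] − [r'] ∈ KZ.changeOfVariablesRel` — ONE move of rule (2) along the Lambert map
`Φ(w) = 2w/√(1+|w|²)` (semialgebraic, differentiable with `|det Φ′| = 4/(1+|w|²)²`, injective with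
inverse `v/√(4−|v|²)`, image the open disc of radius `2`). [cite: KontsevichZagier2001, §1.2] -/
theorem archimedesCoV_proof :
    Summit.KontsevichZagierPeriods.KontsevichZagierPeriods.Theses.LinkTwistWrithe.ArchimedesCoV := by
  intro r r' hrd hri hr'd hr'i
  refine ⟨2, r, r', fun w : Fin 2 → ℝ => (2 / √(1 + w 0 ^ 2 + w 1 ^ 2)) • w,
    fun y => LinearMap.toContinuousLinearMap (Matrix.toLin' !![
        (2 * (1 + y 0 ^ 2 + y 1 ^ 2) - 2 * y 0 * y 0) /
          ((1 + y 0 ^ 2 + y 1 ^ 2) * √(1 + y 0 ^ 2 + y 1 ^ 2)),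
        (-(2 * y 0 * y 1)) / ((1 + y 0 ^ 2 + y 1 ^ 2) * √(1 + y 0 ^ 2 + y 1 ^ 2));
        (-(2 * y 1 * y 0)) / ((1 + y 0 ^ 2 + y 1 ^ 2) * √(1 + y 0 ^ 2 + y 1 ^ 2)),
        (2 * (1 + y 0 ^ 2 + y 1 ^ 2) - 2 * y 1 * y 1) /
          ((1 + y 0 ^ 2 + y 1 ^ 2) * √(1 + y 0 ^ 2 + y 1 ^ 2))]),
    ?_, fun x _ => (hasFDerivAt_lambert x).hasFDerivWithinAt, leftInverse_lambert.injective.injOn,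
    ?_, fun x hx => ?_, rfl⟩
  · rw [hrd]
    exact isSemialgebraicMapOn_lambert
  · rw [hr'd, hrd, image_lambert]
  · have hΦ : (2 / √(1 + x 0 ^ 2 + x 1 ^ 2)) • x ∈ r'.domain := by
      rw [hr'd, ← image_lambert]
      exact Set.mem_image_of_mem _ (Set.mem_univ x)
    rw [hri hx, hr'i hΦ, abs_det_lambert x, one_mul]

end Summit.KontsevichZagierPeriods.LinkTwistWrithe

end
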